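import Summits.SmoothPoincare4.SmoothPoincare4.Theses.SullivanDual
import Literature.Geometry.Symplectic.GromovR4StdModel
import Mathlib.Analysis.Calculus.BumpFunction.InnerProduct

/-!
# SmoothPoincare4 / SullivanDual — crux `Target` (stmt-SmoothPoincare4-7823): `stub_invChartMap`

A smooth cut-off of the inverted recentred chart with PRESCRIBED radius.  For a point `p` of a
smooth Hausdorff 4-manifold `M`, `e = extChartAt (𝓡 4) p`, and a radius `ε' > 0` whose closed
chart-ball `closedBall (e p) ε'` lies in the chart target, there is a `C^∞` map
`Φ : M ∖ {p} → ℝ⁴` which equals `ι ∘ (e − e p)` (`ι z = z / ‖z‖²`) on the punctured chart-ball of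
radius `ε'` and has norm `≤ ε'⁻¹` off it.

Proof.  The chart target is open and contains the compact ball `closedBall (e p) ε'`, hence a
closed ball of radius `R = δ + ε' > ε'`.  With a smooth bump `χ` on `ℝ⁴` equal to `1` on
`closedBall 0 ε'`, vanishing off `ball 0 R`, `0 ≤ χ ≤ 1`, put `Φ z = χ (e z − e p) • ι (e z − e p)`
on the chart source and `Φ z = 0` off it.  Smoothness is verbatim the argument of
`exists_contMDiff_eq_inversion_of_inPuncturedChartBall` (smooth on the open punctured chart source
where `e z − e p ≠ 0`, identically `0` off the compact `e.symm '' closedBall (e p) R`); on the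
punctured `ε'`-ball `χ = 1`; off it either `Φ = 0` or `‖Φ z‖ = χ · ‖e z − e p‖⁻¹ ≤ ε'⁻¹` since
`‖e z − e p‖ ≥ ε'` there (`norm_inversion`).

References: M. Gromov, *Pseudo holomorphic curves in symplectic manifolds*, Invent. Math. 82
(1985), §0.3.C [Gromov1985].
-/

noncomputable section

-- the registered namespace `Summit.SmoothPoincare4.SmoothPoincare4.Theorems` repeats a component
set_option linter.dupNamespace false

open scoped Manifold ContDiff Topology
open Set Filter Metric
open Literature.Geometry.Kaehler Literature.Geometry.Symplectic

namespace Summit.SmoothPoincare4.SmoothPoincare4.Theorems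

namespace SullivanDual

variable {M : Type*} [TopologicalSpace M] [T2Space M] [ChartedSpace (EuclideanSpace ℝ (Fin 4)) M]
  [IsManifold (𝓡 4) ∞ M]

/-- **Stub B (cut-off inverted chart with prescribed radius).** If the closed chart-ball of
radius `ε' > 0` about `e p` lies in the chart target (`e = extChartAt (𝓡 4) p`), there is a
`C^∞` map `Φ : M ∖ {p} → ℝ⁴` which equals the inverted recentred chart `ι ∘ (e − e p)` on the
punctured chart-ball of radius `ε'` and has norm `≤ ε'⁻¹` off it.  Construction:
`Φ = (χ • ι) ∘ (e − e p)` on the chart source and `0` off it, for a bump `χ = 1` on the closed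
`ε'`-ball supported in a slightly larger ball inside the target (cf. the proved
`exists_contMDiff_eq_inversion_of_inPuncturedChartBall`). [folklore] -/
theorem stub_invChartMap (p : M) (ε' : ℝ) (hε' : 0 < ε')
    (hball : Metric.closedBall (extChartAt (𝓡 4) p p) ε' ⊆ (extChartAt (𝓡 4) p).target) :
    ∃ Φ : punctured p → EuclideanSpace ℝ (Fin 4),
      ContMDiff (𝓡 4) (𝓡 4) ∞ Φ ∧
      (∀ x : punctured p, InPuncturedChartBall p ε' x →
        Φ x = inversion (extChartAt (𝓡 4) p x.1 - extChartAt (𝓡 4) p p)) ∧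
      (∀ x : punctured p, ¬ InPuncturedChartBall p ε' x → ‖Φ x‖ ≤ ε'⁻¹) := by
  classical
  set e := extChartAt (𝓡 4) p with he
  set c : EuclideanSpace ℝ (Fin 4) := e p with hc
  -- a slightly larger closed ball inside the (open) chart target
  obtain ⟨δ, hδ, hδt⟩ := (isCompact_closedBall c ε').exists_cthickening_subset_open
    (isOpen_extChartAt_target (I := 𝓡 4) p) hball
  rw [cthickening_closedBall hδ.le hε'.le] at hδt
  -- `hδt : closedBall c (δ + ε') ⊆ e.target`
  have hRt : closedBall c (δ + ε') ⊆ e.target := hδt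
  have hR' : ε' < δ + ε' := by linarith
  -- the bump function, `= 1` on `closedBall 0 ε'`, `= 0` off `ball 0 (δ + ε')`
  let χ : ContDiffBump (0 : EuclideanSpace ℝ (Fin 4)) := ⟨ε', δ + ε', hε', hR'⟩
  -- the cut-off inversion, recentred at `c = e p`
  let Ψ : EuclideanSpace ℝ (Fin 4) → EuclideanSpace ℝ (Fin 4) := fun y =>
    χ (y - c) • inversion (y - c)
  let Φ : punctured p → EuclideanSpace ℝ (Fin 4) := fun z =>
    if z.1 ∈ (chartAt (EuclideanSpace ℝ (Fin 4)) p).source then Ψ (e z.1) else 0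
  -- the open punctured chart source and the closed support region
  let U₀ : Set (punctured p) := Subtype.val ⁻¹' (chartAt (EuclideanSpace ℝ (Fin 4)) p).source
  have hU₀ : IsOpen U₀ :=
    (chartAt (EuclideanSpace ℝ (Fin 4)) p).open_source.preimage continuous_subtype_val
  let K : Set (punctured p) := Subtype.val ⁻¹' (e.symm '' closedBall c (δ + ε'))
  have hK : IsClosed K := by
    have hcpt : IsCompact (e.symm '' closedBall c (δ + ε')) :=
      (isCompact_closedBall c (δ + ε')).image_of_continuousOn
        ((continuousOn_extChartAt_symm (I := 𝓡 4) p).mono hRt)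
    exact hcpt.isClosed.preimage continuous_subtype_val
  have hE : ContMDiffOn (𝓡 4) 𝓘(ℝ, EuclideanSpace ℝ (Fin 4)) ∞ (fun z : punctured p => e z.1) U₀ :=
    (contMDiffOn_extChartAt (I := 𝓡 4) (x := p) (n := ∞)).comp
      (contMDiff_subtype_val (I := 𝓡 4) (n := ∞) (U := punctured p)).contMDiffOn
      (fun z hz => hz)
  -- `Φ` vanishes off `K`
  have hzero : ∀ w : punctured p, w ∉ K → Φ w = 0 := by
    intro w hw
    by_cases hws : w.1 ∈ (chartAt (EuclideanSpace ℝ (Fin 4)) p).source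
    · have hsrc : w.1 ∈ e.source := by rw [he, extChartAt_source]; exact hws
      have hfar : δ + ε' ≤ dist (e w.1 - c) 0 := by
        rw [dist_zero_right, ← dist_eq_norm]
        exact not_lt.1 fun hlt =>
          hw (Set.mem_preimage.2 ⟨e w.1, mem_closedBall.2 hlt.le, e.left_inv hsrc⟩)
      have hχ0 : χ (e w.1 - c) = 0 := χ.zero_of_le_dist hfar
      simp only [Φ, Ψ, if_pos hws, hχ0, zero_smul]
    · simp only [Φ, if_neg hws]
  refine ⟨Φ, ?_, ?_, ?_⟩
  · -- smoothness, pointwise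
    intro z
    by_cases hz : z ∈ U₀
    · -- on the punctured chart source `Φ = Ψ ∘ e`, a smooth composition
      have hzs : z.1 ∈ (chartAt (EuclideanSpace ℝ (Fin 4)) p).source := hz
      have hsrc : z.1 ∈ e.source := by rw [he, extChartAt_source]; exact hzs
      have hne : e z.1 - c ≠ 0 := by
        intro h0
        have h1 : e z.1 = e p := sub_eq_zero.1 h0
        exact (mem_punctured.1 z.2) (e.injOn hsrc (mem_extChartAt_source (I := 𝓡 4) p) h1)
      have hsub : ContDiffAt ℝ ∞ (fun y : EuclideanSpace ℝ (Fin 4) => y - c) (e z.1) :=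
        contDiffAt_id.sub contDiffAt_const
      have h1 : ContDiffAt ℝ ∞ ((χ : EuclideanSpace ℝ (Fin 4) → ℝ) ∘ fun y => y - c) (e z.1) :=
        ContDiffAt.comp (e z.1) (g := (χ : EuclideanSpace ℝ (Fin 4) → ℝ)) (f := fun y => y - c)
          χ.contDiffAt hsub
      have h2 : ContDiffAt ℝ ∞ (inversion ∘ fun y => y - c) (e z.1) :=
        ContDiffAt.comp (e z.1) (g := inversion) (f := fun y => y - c)
          (contDiffAt_inversion hne) hsub
      have hΨ : ContDiffAt ℝ ∞ Ψ (e z.1) := h1.smul h2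
      have hEz : ContMDiffAt (𝓡 4) 𝓘(ℝ, EuclideanSpace ℝ (Fin 4)) ∞
          (fun w : punctured p => e w.1) z :=
        (hE z hz).contMDiffAt (hU₀.mem_nhds hz)
      have hcomp : ContMDiffAt (𝓡 4) 𝓘(ℝ, EuclideanSpace ℝ (Fin 4)) ∞
          (Ψ ∘ fun w : punctured p => e w.1) z :=
        ContDiffAt.comp_contMDiffAt (f := fun w : punctured p => e w.1) (x := z) hΨ hEz
      refine hcomp.congr_of_eventuallyEq ?_
      filter_upwards [hU₀.mem_nhds hz] with w hw
      have hws : w.1 ∈ (chartAt (EuclideanSpace ℝ (Fin 4)) p).source := hw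
      simp only [Φ, Function.comp_apply, if_pos hws]
    · -- off the punctured chart source `Φ` vanishes near `z` (`K ⊆ U₀` is closed)
      have hzK : z ∉ K := by
        intro hzK
        rw [Set.mem_preimage, Set.mem_image] at hzK
        obtain ⟨y, hy, hyz⟩ := hzK
        apply hz
        have h1 : e.symm y ∈ e.source := e.map_target (hRt hy)
        rw [hyz, he, extChartAt_source] at h1
        exact h1
      refine (contMDiffAt_const (c := (0 : EuclideanSpace ℝ (Fin 4)))).congr_of_eventuallyEq ?_
      filter_upwards [hK.isOpen_compl.mem_nhds hzK] with w hw
      exact hzero w hw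
  · -- agreement with `ι ∘ (e − e p)` on the punctured ball of radius `ε'`
    intro x hx
    have hx1 : x.1 ∈ (chartAt (EuclideanSpace ℝ (Fin 4)) p).source := hx.1
    have hx2 : e x.1 ∈ ball c ε' := hx.2
    have hχ1 : χ (e x.1 - c) = 1 := χ.one_of_mem_closedBall (by
      rw [mem_closedBall, dist_zero_right, ← dist_eq_norm]
      exact (mem_ball.1 hx2).le)
    simp only [Φ, Ψ, if_pos hx1, hχ1, one_smul]
  · -- the norm bound `‖Φ x‖ ≤ ε'⁻¹` off the punctured ball of radius `ε'`
    intro x hx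
    by_cases hxs : x.1 ∈ (chartAt (EuclideanSpace ℝ (Fin 4)) p).source
    · -- in the chart source but outside the `ε'`-ball: `‖e x − c‖ ≥ ε'`
      have hfar : ε' ≤ ‖e x.1 - c‖ := by
        rw [← dist_eq_norm]
        exact not_lt.1 fun hlt => hx ⟨hxs, mem_ball.2 hlt⟩
      have hΦx : Φ x = χ (e x.1 - c) • inversion (e x.1 - c) := by
        simp only [Φ, Ψ, if_pos hxs]
      rw [hΦx, norm_smul, norm_inversion, Real.norm_of_nonneg χ.nonneg]
      calc χ (e x.1 - c) * ‖e x.1 - c‖⁻¹ ≤ 1 * ε'⁻¹ :=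
            mul_le_mul χ.le_one (inv_anti₀ hε' hfar) (inv_nonneg.2 (norm_nonneg _)) zero_le_one
        _ = ε'⁻¹ := one_mul _
    · -- off the chart source `Φ x = 0`
      have hΦx : Φ x = 0 := by simp only [Φ, if_neg hxs]
      rw [hΦx, norm_zero]
      exact inv_nonneg.2 hε'.le

end SullivanDual

end Summit.SmoothPoincare4.SmoothPoincare4.Theorems

end
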